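import Summits.QuantumFields.YangMills.Theorems.AllWindowsColdBoxBoxHighLineGaussianChartWickPosDef

/-!
# T-S5.4w″ «Wick's theorem for `exp(−β vᵀPv) dv` over an ARBITRARY finite index type»

Corollary file of ✓T-S5.4w/4w′ (`GaussianChartWick`, `GaussianChartWickPosDef`), which are stated on `Fin n → ℝ` (the letters of ✓4a).  The two
Gaussians of the S5/U5 programme (LINE-19 ⟨stmt-QuantumFields-24004⟩/⟨24335⟩ `stub_landauSecondOrder`, LINE-20 ⟨24336⟩) are indexed by
structured finite types: the Faddeev–Popov chart by `↥(interiorSites H) × Fin 3` (w2's `fpOperator`), the MAIN Gaussian of the second-order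
expansion by the Landau free edges `LandauFree H` (precision `hodgeQ H`, ✓S2 `DirProjKernelHodgeForm`), and fcl-p3's 4k frame is «abstract on
`ι → ℝ`».  This file transports 4w′ along `Fintype.equivFin ι` (Mathlib `MeasurableEquiv.piCongrLeft` is volume preserving; matrices by
`Matrix.submatrix`), so that every statement holds verbatim for a positive-definite `P : Matrix ι ι ℝ`:

* `integral_comp_equivFin` — `∫_{ι → ℝ} G(v) dv = ∫_{Fin |ι| → ℝ} G(w ∘ e) dw`, `e = Fintype.equivFin ι`;
* **`integral_exp_neg_quadForm'`** — `∫ exp(−β vᵀPv) dv = √(π/β)^{|ι|}/√(det P)`;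
* **`integral_prod_dotProduct_mul_exp_quadForm_eq_pairingSum'`** — Wick of every order, propagator `S(a,b) = (2β)⁻¹ · a ⬝ᵥ P⁻¹ b`;
  `…_odd'`; `k = 1, 2` (`integral_dotProduct_mul_dotProduct_mul_exp_quadForm'`, `integral_four_dotProduct_mul_exp_quadForm'`);
* `integral_sq_mul_sq_mul_exp_quadForm'` — the «covariance of two squares = 2·(two-point)²» identity (shape of S5's Gaussian main term).

Tree (✓GaussianChartWickPosDef) + Mathlib; no definitions.  HONEST LABEL: infrastructure for step (2) of the XL stubs S5/U5; T-S5.4J, S5, U5, ⟨24004⟩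
⟨24335⟩ ⟨24336⟩ remain OPEN; no summit is proved; the Yang–Mills mass gap is NOT proved by this file.  Seat ym-line-sfw-p2 g77 (LEAD, cell ym-idea-1).
-/

set_option autoImplicit false

noncomputable section

open MeasureTheory Matrix Finset
open Literature.Probability.LatticeModels (pairingSum pairingSum_congr_of_eq)

namespace Summit.QuantumFields.YangMills.Theorems.AllWindowsColdBoxBoxHighLine

namespace GaussianChartWick

variable {ι : Type*} [Fintype ι]

/-- The reindexing map `w ↦ w ∘ e` (`e = Fintype.equivFin ι`) as Mathlib's `piCongrLeft`, pointwise. -/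
theorem piCongrLeft_equivFin_symm_apply (w : Fin (Fintype.card ι) → ℝ) (i : ι) :
    MeasurableEquiv.piCongrLeft (fun _ : ι => ℝ) (Fintype.equivFin ι).symm w i = w (Fintype.equivFin ι i) := by
  have h := MeasurableEquiv.piCongrLeft_apply_apply (Fintype.equivFin ι).symm (β := fun _ : ι => ℝ) w (Fintype.equivFin ι i)
  rwa [Equiv.symm_apply_apply] at h

/-- **Reindexing the integral**: `∫_{ι → ℝ} G(v) dv = ∫_{Fin |ι| → ℝ} G(w ∘ e) dw` for every `G`. -/
theorem integral_comp_equivFin (G : (ι → ℝ) → ℝ) :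
    ∫ w : Fin (Fintype.card ι) → ℝ, G (fun i => w (Fintype.equivFin ι i)) = ∫ v : ι → ℝ, G v := by
  have hmp := volume_measurePreserving_piCongrLeft (fun _ : ι => ℝ) (Fintype.equivFin ι).symm
  have h := hmp.integral_comp' G
  have hfun : (fun w : Fin (Fintype.card ι) → ℝ => G (MeasurableEquiv.piCongrLeft (fun _ : ι => ℝ) (Fintype.equivFin ι).symm w)) =
      fun w => G (fun i => w (Fintype.equivFin ι i)) := by
    funext w
    congr 1
    funext i
    exact piCongrLeft_equivFin_symm_apply w i
  rw [hfun] at h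
  exact h

/-- Dot products reindex: `(a ∘ e⁻¹) ⬝ᵥ (b ∘ e⁻¹) = a ⬝ᵥ b`. -/
theorem dotProduct_comp_equivFin_symm (a b : ι → ℝ) :
    (fun j => a ((Fintype.equivFin ι).symm j)) ⬝ᵥ (fun j => b ((Fintype.equivFin ι).symm j)) = a ⬝ᵥ b := by
  simp only [dotProduct]
  exact Equiv.sum_comp (Fintype.equivFin ι).symm (fun i => a i * b i)

/-- The reindexed matrix acts by `P' (b ∘ e⁻¹) = (P b) ∘ e⁻¹`. -/
theorem submatrix_equivFin_mulVec (P : Matrix ι ι ℝ) (b : ι → ℝ) :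
    P.submatrix (Fintype.equivFin ι).symm (Fintype.equivFin ι).symm *ᵥ (fun j => b ((Fintype.equivFin ι).symm j)) =
      fun j => (P *ᵥ b) ((Fintype.equivFin ι).symm j) := by
  rw [Matrix.submatrix_mulVec_equiv]
  funext j
  simp only [Function.comp_apply]
  congr 1
  funext i
  simp only [Function.comp_apply, Equiv.symm_symm, Equiv.symm_apply_apply]

/-- Quadratic / bilinear forms reindex: `(a ∘ e⁻¹) ⬝ᵥ P' (b ∘ e⁻¹) = a ⬝ᵥ P b` with `P' = P.submatrix e⁻¹ e⁻¹`. -/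
theorem dotProduct_submatrix_equivFin_mulVec (P : Matrix ι ι ℝ) (a b : ι → ℝ) :
    (fun j => a ((Fintype.equivFin ι).symm j)) ⬝ᵥ
        (P.submatrix (Fintype.equivFin ι).symm (Fintype.equivFin ι).symm *ᵥ fun j => b ((Fintype.equivFin ι).symm j)) =
      a ⬝ᵥ (P *ᵥ b) := by
  rw [submatrix_equivFin_mulVec, dotProduct_comp_equivFin_symm]

end GaussianChartWick

open GaussianChartWick

section Fintype

variable {ι : Type*} [Fintype ι]

/-- The reindexed matrix `P' = P.submatrix e⁻¹ e⁻¹` (`e = Fintype.equivFin ι`) is positive definite with the same determinant, and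
`P'⁻¹ = P⁻¹.submatrix e⁻¹ e⁻¹`. -/
theorem posDef_submatrix_equivFin (P : Matrix ι ι ℝ) (hP : P.PosDef) :
    (P.submatrix (Fintype.equivFin ι).symm (Fintype.equivFin ι).symm).PosDef :=
  hP.submatrix (Fintype.equivFin ι).symm.injective

/-- Undoing the reindexing of a vector: `(w ∘ e) ∘ e⁻¹ = w`. -/
theorem comp_equivFin_comp_symm (w : Fin (Fintype.card ι) → ℝ) :
    (fun j => (fun i => w (Fintype.equivFin ι i)) ((Fintype.equivFin ι).symm j)) = w := by
  funext j; simp only [Equiv.apply_symm_apply]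

/-- The quadratic form in reindexed coordinates. -/
theorem quadForm_comp_equivFin (P : Matrix ι ι ℝ) (w : Fin (Fintype.card ι) → ℝ) :
    (fun i => w (Fintype.equivFin ι i)) ⬝ᵥ (P *ᵥ fun i => w (Fintype.equivFin ι i)) =
      w ⬝ᵥ (P.submatrix (Fintype.equivFin ι).symm (Fintype.equivFin ι).symm *ᵥ w) := by
  have h := dotProduct_submatrix_equivFin_mulVec P (fun i => w (Fintype.equivFin ι i)) (fun i => w (Fintype.equivFin ι i))
  rw [comp_equivFin_comp_symm] at h
  exact h.symm

/-- A linear form in reindexed coordinates. -/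
theorem dotProduct_comp_equivFin (a : ι → ℝ) (w : Fin (Fintype.card ι) → ℝ) :
    a ⬝ᵥ (fun i => w (Fintype.equivFin ι i)) = (fun j => a ((Fintype.equivFin ι).symm j)) ⬝ᵥ w := by
  have h := dotProduct_comp_equivFin_symm a (fun i => w (Fintype.equivFin ι i))
  rw [comp_equivFin_comp_symm] at h
  exact h.symm

variable [DecidableEq ι]

/-- Reindexing along `Fintype.equivFin ι` preserves the determinant. -/
theorem det_submatrix_equivFin (P : Matrix ι ι ℝ) :
    (P.submatrix (Fintype.equivFin ι).symm (Fintype.equivFin ι).symm).det = P.det :=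
  Matrix.det_submatrix_equiv_self _ P

/-- Reindexing along `Fintype.equivFin ι` commutes with the matrix inverse. -/
theorem inv_submatrix_equivFin (P : Matrix ι ι ℝ) :
    (P.submatrix (Fintype.equivFin ι).symm (Fintype.equivFin ι).symm)⁻¹ =
      P⁻¹.submatrix (Fintype.equivFin ι).symm (Fintype.equivFin ι).symm :=
  Matrix.inv_submatrix_equiv P _ _

/-- **Normalisation over `ι → ℝ`**: `∫ exp(−β vᵀPv) dv = √(π/β)^{|ι|}/√(det P)`. -/
theorem integral_exp_neg_quadForm' (P : Matrix ι ι ℝ) (hP : P.PosDef) {β : ℝ} (hβ : 0 < β) :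
    ∫ v : ι → ℝ, Real.exp (-(β * (v ⬝ᵥ P *ᵥ v))) = Real.sqrt (Real.pi / β) ^ Fintype.card ι / Real.sqrt P.det := by
  rw [← integral_comp_equivFin, ← det_submatrix_equivFin P,
    ← integral_exp_neg_quadForm _ _ (posDef_submatrix_equivFin P hP) hβ]
  refine integral_congr_ae (Filter.Eventually.of_forall fun w => ?_)
  simp only [quadForm_comp_equivFin]

/-- **WICK'S THEOREM over `ι → ℝ`**: for a positive-definite `P : Matrix ι ι ℝ`, `β > 0` and `2k` linear forms,
`∫ (∏_i ℓ_i ⬝ᵥ v) exp(−β vᵀPv) dv = √(π/β)^{|ι|}/√(det P) · 𝒢_k[S](ℓ)`, `S(a,b) = (2β)⁻¹ · a ⬝ᵥ P⁻¹ b`. -/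
theorem integral_prod_dotProduct_mul_exp_quadForm_eq_pairingSum' (P : Matrix ι ι ℝ) (hP : P.PosDef) {β : ℝ} (hβ : 0 < β)
    (k : ℕ) (ℓ : Fin (2 * k) → (ι → ℝ)) :
    ∫ v : ι → ℝ, (∏ i, (ℓ i ⬝ᵥ v)) * Real.exp (-(β * (v ⬝ᵥ P *ᵥ v))) =
      Real.sqrt (Real.pi / β) ^ Fintype.card ι / Real.sqrt P.det *
        pairingSum (fun a b : ι → ℝ => (2 * β)⁻¹ * (a ⬝ᵥ (P⁻¹ *ᵥ b))) k ℓ := by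
  have h := integral_prod_dotProduct_mul_exp_quadForm_eq_pairingSum _ _ (posDef_submatrix_equivFin P hP) hβ k
    (fun i j => ℓ i ((Fintype.equivFin ι).symm j))
  have hpair : pairingSum (fun a b : Fin (Fintype.card ι) → ℝ =>
        (2 * β)⁻¹ * (a ⬝ᵥ ((P.submatrix (Fintype.equivFin ι).symm (Fintype.equivFin ι).symm)⁻¹ *ᵥ b))) k
        (fun i j => ℓ i ((Fintype.equivFin ι).symm j)) =
      pairingSum (fun a b : ι → ℝ => (2 * β)⁻¹ * (a ⬝ᵥ (P⁻¹ *ᵥ b))) k ℓ := by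
    refine pairingSum_congr_of_eq _ _ k _ ℓ fun i j => ?_
    rw [inv_submatrix_equivFin, dotProduct_submatrix_equivFin_mulVec]
  rw [← integral_comp_equivFin, ← det_submatrix_equivFin P, ← hpair, ← h]
  refine integral_congr_ae (Filter.Eventually.of_forall fun w => ?_)
  simp only [quadForm_comp_equivFin, dotProduct_comp_equivFin]

omit [DecidableEq ι] in
/-- Odd moments vanish over `ι → ℝ`. -/
theorem integral_prod_dotProduct_mul_exp_quadForm_odd' (P : Matrix ι ι ℝ) (hP : P.PosDef) {β : ℝ} (hβ : 0 < β)
    (k : ℕ) (ℓ : Fin (2 * k + 1) → (ι → ℝ)) :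
    ∫ v : ι → ℝ, (∏ i, (ℓ i ⬝ᵥ v)) * Real.exp (-(β * (v ⬝ᵥ P *ᵥ v))) = 0 := by
  have h := integral_prod_dotProduct_mul_exp_quadForm_odd _ _ (posDef_submatrix_equivFin P hP) hβ k
    (fun i j => ℓ i ((Fintype.equivFin ι).symm j))
  rw [← integral_comp_equivFin, ← h]
  refine integral_congr_ae (Filter.Eventually.of_forall fun w => ?_)
  simp only [quadForm_comp_equivFin, dotProduct_comp_equivFin]

/-- The propagator (`k = 1`) over `ι → ℝ`. -/
theorem integral_dotProduct_mul_dotProduct_mul_exp_quadForm' (P : Matrix ι ι ℝ) (hP : P.PosDef) {β : ℝ} (hβ : 0 < β)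
    (a b : ι → ℝ) :
    ∫ v : ι → ℝ, (a ⬝ᵥ v) * (b ⬝ᵥ v) * Real.exp (-(β * (v ⬝ᵥ P *ᵥ v))) =
      Real.sqrt (Real.pi / β) ^ Fintype.card ι / Real.sqrt P.det * ((2 * β)⁻¹ * (a ⬝ᵥ (P⁻¹ *ᵥ b))) := by
  have h := integral_dotProduct_mul_dotProduct_mul_exp_quadForm _ _ (posDef_submatrix_equivFin P hP) hβ
    (fun j => a ((Fintype.equivFin ι).symm j)) (fun j => b ((Fintype.equivFin ι).symm j))
  rw [inv_submatrix_equivFin, dotProduct_submatrix_equivFin_mulVec, det_submatrix_equivFin] at h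
  rw [← integral_comp_equivFin, ← h]
  refine integral_congr_ae (Filter.Eventually.of_forall fun w => ?_)
  simp only [quadForm_comp_equivFin, dotProduct_comp_equivFin]

/-- The four-point function (`k = 2`) over `ι → ℝ`, `S(a,b) = (2β)⁻¹ · a ⬝ᵥ P⁻¹ b`. -/
theorem integral_four_dotProduct_mul_exp_quadForm' (P : Matrix ι ι ℝ) (hP : P.PosDef) {β : ℝ} (hβ : 0 < β)
    (ℓ₀ ℓ₁ ℓ₂ ℓ₃ : ι → ℝ) :
    ∫ v : ι → ℝ, (ℓ₀ ⬝ᵥ v) * (ℓ₁ ⬝ᵥ v) * (ℓ₂ ⬝ᵥ v) * (ℓ₃ ⬝ᵥ v) * Real.exp (-(β * (v ⬝ᵥ P *ᵥ v))) =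
      Real.sqrt (Real.pi / β) ^ Fintype.card ι / Real.sqrt P.det *
        (((2 * β)⁻¹ * (ℓ₀ ⬝ᵥ (P⁻¹ *ᵥ ℓ₁))) * ((2 * β)⁻¹ * (ℓ₂ ⬝ᵥ (P⁻¹ *ᵥ ℓ₃))) +
         ((2 * β)⁻¹ * (ℓ₀ ⬝ᵥ (P⁻¹ *ᵥ ℓ₂))) * ((2 * β)⁻¹ * (ℓ₁ ⬝ᵥ (P⁻¹ *ᵥ ℓ₃))) +
         ((2 * β)⁻¹ * (ℓ₀ ⬝ᵥ (P⁻¹ *ᵥ ℓ₃))) * ((2 * β)⁻¹ * (ℓ₁ ⬝ᵥ (P⁻¹ *ᵥ ℓ₂)))) := by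
  have h := integral_four_dotProduct_mul_exp_quadForm _ _ (posDef_submatrix_equivFin P hP) hβ
    (fun j => ℓ₀ ((Fintype.equivFin ι).symm j)) (fun j => ℓ₁ ((Fintype.equivFin ι).symm j))
    (fun j => ℓ₂ ((Fintype.equivFin ι).symm j)) (fun j => ℓ₃ ((Fintype.equivFin ι).symm j))
  simp only [inv_submatrix_equivFin, dotProduct_submatrix_equivFin_mulVec, det_submatrix_equivFin] at h
  rw [← integral_comp_equivFin, ← h]
  refine integral_congr_ae (Filter.Eventually.of_forall fun w => ?_)
  simp only [quadForm_comp_equivFin, dotProduct_comp_equivFin]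

/-- **Covariance of two squares over `ι → ℝ`** (the shape of S5's Gaussian main term):
`Z·∫(a⬝v)²(b⬝v)²e^{−βvᵀPv} = (∫(a⬝v)²e^{−βvᵀPv})(∫(b⬝v)²e^{−βvᵀPv}) + Z²·2·S(a,b)²`, `Z = √(π/β)^{|ι|}/√det P`, `S(a,b) = (2β)⁻¹a⬝P⁻¹b`. -/
theorem integral_sq_mul_sq_mul_exp_quadForm' (P : Matrix ι ι ℝ) (hP : P.PosDef) {β : ℝ} (hβ : 0 < β) (a b : ι → ℝ) :
    Real.sqrt (Real.pi / β) ^ Fintype.card ι / Real.sqrt P.det *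
        ∫ v : ι → ℝ, (a ⬝ᵥ v) ^ 2 * (b ⬝ᵥ v) ^ 2 * Real.exp (-(β * (v ⬝ᵥ P *ᵥ v))) =
      (∫ v : ι → ℝ, (a ⬝ᵥ v) ^ 2 * Real.exp (-(β * (v ⬝ᵥ P *ᵥ v)))) *
        (∫ v : ι → ℝ, (b ⬝ᵥ v) ^ 2 * Real.exp (-(β * (v ⬝ᵥ P *ᵥ v)))) +
      (Real.sqrt (Real.pi / β) ^ Fintype.card ι / Real.sqrt P.det) ^ 2 * (2 * ((2 * β)⁻¹ * (a ⬝ᵥ (P⁻¹ *ᵥ b))) ^ 2) := by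
  have h4 := integral_four_dotProduct_mul_exp_quadForm' P hP hβ a a b b
  have ha := integral_dotProduct_mul_dotProduct_mul_exp_quadForm' P hP hβ a a
  have hb := integral_dotProduct_mul_dotProduct_mul_exp_quadForm' P hP hβ b b
  have h4' : ∫ v : ι → ℝ, (a ⬝ᵥ v) ^ 2 * (b ⬝ᵥ v) ^ 2 * Real.exp (-(β * (v ⬝ᵥ P *ᵥ v))) =
      ∫ v : ι → ℝ, (a ⬝ᵥ v) * (a ⬝ᵥ v) * (b ⬝ᵥ v) * (b ⬝ᵥ v) * Real.exp (-(β * (v ⬝ᵥ P *ᵥ v))) :=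
    integral_congr_ae (Filter.Eventually.of_forall fun v => by ring)
  have ha' : ∫ v : ι → ℝ, (a ⬝ᵥ v) ^ 2 * Real.exp (-(β * (v ⬝ᵥ P *ᵥ v))) =
      ∫ v : ι → ℝ, (a ⬝ᵥ v) * (a ⬝ᵥ v) * Real.exp (-(β * (v ⬝ᵥ P *ᵥ v))) :=
    integral_congr_ae (Filter.Eventually.of_forall fun v => by ring)
  have hb' : ∫ v : ι → ℝ, (b ⬝ᵥ v) ^ 2 * Real.exp (-(β * (v ⬝ᵥ P *ᵥ v))) =
      ∫ v : ι → ℝ, (b ⬝ᵥ v) * (b ⬝ᵥ v) * Real.exp (-(β * (v ⬝ᵥ P *ᵥ v))) :=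
    integral_congr_ae (Filter.Eventually.of_forall fun v => by ring)
  rw [h4', ha', hb', h4, ha, hb]
  ring

end Fintype

end Summit.QuantumFields.YangMills.Theorems.AllWindowsColdBoxBoxHighLine

end
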